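import Summits.Ventures.PercRepro.Multi

/-!
# PercRepro — the antipodal principle for ANY kernel at ANY `k`, and C-017 (typer-2, gen 4)

The general form of `MinorC011.lean` / `Multi.lean` (lead 07:12:05Z (1): «type the k = 3 antipodal
principle so C-017's ≤ 6-vertex theorem has its Lean shape»): for a kernel
`A : Setoid (Fin k) → Setoid (Fin k) → ℝ` the quadratic form `G.quadForm p m A` (`SMC.lean`, already
the two-copy sum) is the weighted sum over classes of the class sums of `A` on the marked minors
(`quadForm_eq_sum_faces`, `faceSumQuad_eq_minor`, `quadForm_nonneg_of_minors`); class positivity of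
`A` on every marked multigraph with `≤ N` vertices — even on the SIMPLE ones only — gives the form
at every `p` on every multigraph with `≤ N` vertices (`ClassPositiveUpTo`,
`ClassPositiveSimpleUpTo`, **`QuadNonnegUpTo_of_classPositive`**, **`QuadNonnegUpTo_of_simple`**).

C-017 (mine-3's Q1, CONJECTURES v37): `P(a~b)·P(a≁b) ≤ P(ab|c) + P(ac|b) + P(bc|a)` on the `law3`
rows — **`C017`**, its kernel `kernel17` with **`quadForm_kernel17`** (the form IS the row slack),
`C017_iff_quadForm`, **`C017UpTo N`**, **`C017UpTo_of_classPositive`**, **`C017UpTo_of_simple`**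
(mine-3's exhaustive class positivity on ≤ 6 vertices is `ClassPositiveSimpleUpTo 3 6 kernel17`).
-/

namespace PercRepro

open Finset

namespace MultiGraph

variable {V E : Type*} (G : MultiGraph V E) [Fintype E] [DecidableEq E] {k : ℕ}

/-- The class sum of a setoid kernel `A` on the class `(join u, meet v)`. -/
noncomputable def faceSumQuad (m : Fin k → V) (A : Setoid (Fin k) → Setoid (Fin k) → ℝ)
    (u v : Config E) : ℝ :=
  faceSum A (fun ω => G.markedPartition ω m) u v

/-- The full-cube class sum of a setoid kernel `A` (ordered antipodal pairs). -/
noncomputable def cubeSumQuad (m : Fin k → V) (A : Setoid (Fin k) → Setoid (Fin k) → ℝ) : ℝ :=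
  cubeSum A fun ω => G.markedPartition ω m

/-- **The antipodal principle**: the class sum of a class is the full-cube class sum of its marked
minor. -/
theorem faceSumQuad_eq_minor (m : Fin k → V) (A : Setoid (Fin k) → Setoid (Fin k) → ℝ)
    (u v : Config E) :
    G.faceSumQuad m A u v = (G.minor u v).cubeSumQuad (fun i => G.sureClass v (m i)) A := by
  unfold faceSumQuad cubeSumQuad faceSum cubeSum
  refine Finset.sum_congr rfl fun ρ _ => ?_
  dsimp only
  rw [G.markedPartition_embed, G.markedPartition_embed]

open Classical in
/-- **The quadratic form of a kernel is the weighted sum of its class sums.** -/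
theorem quadForm_eq_sum_faces (p : E → ℝ) (m : Fin k → V)
    (A : Setoid (Fin k) → Setoid (Fin k) → ℝ) :
    G.quadForm p m A = ∑ uv : Config E × Config E, weight p uv.2 * weight p uv.1 *
      if uv.2 ≤ uv.1 then G.faceSumQuad m A uv.1 uv.2 else 0 := by
  unfold quadForm
  rw [twoCopy_eq_sum_faces p (fun ω => G.markedPartition ω m) A]
  rfl

/-- **The form is nonnegative on one graph at every `p`** once every marked minor has a
nonnegative class sum. -/
theorem quadForm_nonneg_of_minors {p : E → ℝ} (hp : IsProb p) (m : Fin k → V)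
    (A : Setoid (Fin k) → Setoid (Fin k) → ℝ)
    (h : ∀ u v : Config E, v ≤ u →
      0 ≤ (G.minor u v).cubeSumQuad (fun i => G.sureClass v (m i)) A) :
    0 ≤ G.quadForm p m A := by
  rw [G.quadForm_eq_sum_faces]
  refine Finset.sum_nonneg fun uv _ => ?_
  refine mul_nonneg (mul_nonneg (weight_nonneg hp _) (weight_nonneg hp _)) ?_
  split_ifs with hle
  · rw [G.faceSumQuad_eq_minor]
    exact h uv.1 uv.2 hle
  · exact le_rfl

omit [Fintype E] in
/-- The marked partition is blind to a parallel edge when its twin is open. -/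
theorem markedPartition_update_of_parallel {e e' : E} (hne : e ≠ e') (hpar : G.Parallel e e')
    (m : Fin k → V) (ω : Config E) (b : Bool) (h : ω e = true) :
    G.markedPartition (Function.update ω e' b) m = G.markedPartition ω m := by
  ext i j
  exact G.conn_update_iff_of_parallel hne.symm hpar.symm h b (m i) (m j)

omit [Fintype E] in
/-- The marked partition is blind to a loop. -/
theorem markedPartition_update_of_loop {e : E} (he : G.fst e = G.snd e) (m : Fin k → V)
    (ω : Config E) (b : Bool) :
    G.markedPartition (Function.update ω e b) m = G.markedPartition ω m := by
  ext i j
  exact G.conn_update_iff_of_loop he ω b (m i) (m j)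

/-- `CS = CS(G − e') + 2·CS(G/e − e')` for a parallel pair, any kernel. -/
theorem cubeSumQuad_parallel {e e' : E} (hne : e ≠ e') (hpar : G.Parallel e e') (m : Fin k → V)
    (A : Setoid (Fin k) → Setoid (Fin k) → ℝ) :
    G.cubeSumQuad m A = cubeSumDel A (fun ρ => G.markedPartition ρ m) e' +
      2 * cubeSumDelCon A (fun ρ => G.markedPartition ρ m) e' e :=
  cubeSum_parallel _ _ hne (fun ω b h => G.markedPartition_update_of_parallel hne hpar m ω b h)
    (fun ω b h => G.markedPartition_update_of_parallel hne.symm hpar.symm m ω b h)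

/-- `CS = 2·CS(G − e)` for a loop, any kernel. -/
theorem cubeSumQuad_loop {e : E} (he : G.fst e = G.snd e) (m : Fin k → V)
    (A : Setoid (Fin k) → Setoid (Fin k) → ℝ) :
    G.cubeSumQuad m A = 2 * cubeSumDel A (fun ρ => G.markedPartition ρ m) e :=
  cubeSum_loop _ _ e fun ω b => G.markedPartition_update_of_loop he m ω b

/-- `CS(G − e')` is the class sum of the minor «`e'` deleted», any kernel. -/
theorem cubeSumDel_eq_minorQuad (m : Fin k → V) (A : Setoid (Fin k) → Setoid (Fin k) → ℝ)
    (e' : E) :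
    cubeSumDel A (fun ρ => G.markedPartition ρ m) e' =
      (G.minor (fun x => decide (x ≠ e')) ⊥).cubeSumQuad (fun i => G.sureClass ⊥ (m i)) A := by
  rw [cubeSumDel_eq_faceSum, ← G.faceSumQuad_eq_minor]
  rfl

/-- `CS(G/e − e')` is the class sum of the minor «`e'` deleted, `e` contracted», any kernel. -/
theorem cubeSumDelCon_eq_minorQuad (m : Fin k → V) (A : Setoid (Fin k) → Setoid (Fin k) → ℝ)
    {e' e : E} (hne : e ≠ e') :
    cubeSumDelCon A (fun ρ => G.markedPartition ρ m) e' e =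
      (G.minor (fun x => decide (x ≠ e')) (fun x => decide (x = e))).cubeSumQuad
        (fun i => G.sureClass (fun x => decide (x = e)) (m i)) A := by
  rw [cubeSumDelCon_eq_faceSum _ _ hne, ← G.faceSumQuad_eq_minor]
  rfl

end MultiGraph

/-! ### Class positivity on at most `N` vertices -/

/-- **`A` is class-positive on ≤ N vertices**: its full-cube class sum is nonnegative on every
marked multigraph with at most `N` vertices. -/
def ClassPositiveUpTo (k N : ℕ) (A : Setoid (Fin k) → Setoid (Fin k) → ℝ) : Prop :=
  ∀ {V E : Type} [Fintype V] [Fintype E] [DecidableEq E], Fintype.card V ≤ N →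
    ∀ (G : MultiGraph V E) (m : Fin k → V), 0 ≤ G.cubeSumQuad m A

/-- **`A` is class-positive on the SIMPLE graphs with ≤ N vertices** (a finite census). -/
def ClassPositiveSimpleUpTo (k N : ℕ) (A : Setoid (Fin k) → Setoid (Fin k) → ℝ) : Prop :=
  ∀ {V E : Type} [Fintype V] [Fintype E] [DecidableEq E], Fintype.card V ≤ N →
    ∀ (G : MultiGraph V E), G.IsSimple → ∀ m : Fin k → V, 0 ≤ G.cubeSumQuad m A

/-- **The quadratic form of `A` is nonnegative on every multigraph with ≤ N vertices**, every `p`,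
every marking. -/
def QuadNonnegUpTo (k N : ℕ) (A : Setoid (Fin k) → Setoid (Fin k) → ℝ) : Prop :=
  ∀ {V E : Type} [Fintype V] [Fintype E] [DecidableEq E], Fintype.card V ≤ N →
    ∀ (G : MultiGraph V E) (p : E → ℝ), IsProb p → ∀ m : Fin k → V, 0 ≤ G.quadForm p m A

/-- **Class positivity on ≤ N vertices gives the form on ≤ N vertices** (the minors of `G` live on
the quotients of `V`). -/
theorem QuadNonnegUpTo_of_classPositive {k N : ℕ} {A : Setoid (Fin k) → Setoid (Fin k) → ℝ}
    (h : ClassPositiveUpTo k N A) : QuadNonnegUpTo k N A := by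
  intro V E _ _ _ hV G p hp m
  refine G.quadForm_nonneg_of_minors hp m A fun u v _ => ?_
  classical
  exact h ((Fintype.card_quotient_le (G.connSetoid v)).trans hV) (G.minor u v) _

/-- **Class positivity on the simple graphs gives it on all multigraphs with ≤ N vertices**
(induction on the number of edges, as in `Multi.lean`). -/
theorem ClassPositiveUpTo_of_simple {k N : ℕ} {A : Setoid (Fin k) → Setoid (Fin k) → ℝ}
    (h : ClassPositiveSimpleUpTo k N A) : ClassPositiveUpTo k N A := by
  intro V E _ _ _ hV G m
  suffices key : ∀ n : ℕ, ∀ (V E : Type) [Fintype V] [Fintype E] [DecidableEq E],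
      Fintype.card E = n → Fintype.card V ≤ N → ∀ (G : MultiGraph V E) (m : Fin k → V),
        0 ≤ G.cubeSumQuad m A from key _ V E rfl hV G m
  intro n
  induction n using Nat.strong_induction_on with
  | _ n ih =>
    intro V E _ _ _ hE hV G m
    classical
    by_cases hl : ∃ e, G.fst e = G.snd e
    · obtain ⟨e, he⟩ := hl
      rw [G.cubeSumQuad_loop he, G.cubeSumDel_eq_minorQuad]
      have hlt : Fintype.card (Face (fun x => decide (x ≠ e)) (⊥ : Config E)) < n := by
        rw [← hE]
        exact Fintype.card_subtype_lt (x := e) (by simp)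
      have := ih _ hlt _ _ rfl ((Fintype.card_quotient_le (G.connSetoid ⊥)).trans hV)
        (G.minor (fun x => decide (x ≠ e)) ⊥) (fun i => G.sureClass ⊥ (m i))
      linarith
    by_cases hp : ∃ e e', G.Parallel e e' ∧ e ≠ e'
    · obtain ⟨e, e', hpar, hne⟩ := hp
      rw [G.cubeSumQuad_parallel hne hpar, G.cubeSumDel_eq_minorQuad,
        G.cubeSumDelCon_eq_minorQuad m A hne]
      have hlt₁ : Fintype.card (Face (fun x => decide (x ≠ e')) (⊥ : Config E)) < n := by
        rw [← hE]
        exact Fintype.card_subtype_lt (x := e') (by simp)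
      have hlt₂ : Fintype.card (Face (fun x => decide (x ≠ e')) (fun x => decide (x = e))) < n := by
        rw [← hE]
        exact Fintype.card_subtype_lt (x := e') (by simp)
      have h₁ := ih _ hlt₁ _ _ rfl ((Fintype.card_quotient_le (G.connSetoid ⊥)).trans hV)
        (G.minor (fun x => decide (x ≠ e')) ⊥) (fun i => G.sureClass ⊥ (m i))
      have h₂ := ih _ hlt₂ _ _ rfl
        ((Fintype.card_quotient_le (G.connSetoid fun x => decide (x = e))).trans hV)
        (G.minor (fun x => decide (x ≠ e')) (fun x => decide (x = e)))
        (fun i => G.sureClass (fun x => decide (x = e)) (m i))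
      linarith
    · push Not at hl hp
      exact h hV G ⟨hl, hp⟩ m

/-- **The simple-graph class census gives the form on every multigraph with ≤ N vertices.** -/
theorem QuadNonnegUpTo_of_simple {k N : ℕ} {A : Setoid (Fin k) → Setoid (Fin k) → ℝ}
    (h : ClassPositiveSimpleUpTo k N A) : QuadNonnegUpTo k N A :=
  QuadNonnegUpTo_of_classPositive (ClassPositiveUpTo_of_simple h)

/-! ### C-017: `P(a~b)·P(a≁b) ≤ P(exactly one pair)` -/

/-- **C-017** (mine-3's Q1, CONJECTURES v37 2026-08-22T07:11:30Z): for every finite multigraph,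
`p ∈ [0,1]^E` and marks `a, b, c`, `P(a~b)·P(a≁b) ≤ P(ab|c) + P(ac|b) + P(bc|a)` — on the `law3`
rows `(x + y₁)(y₂ + y₃ + z) ≤ y₁ + y₂ + y₃` (`Var(1_{a~b}) ≤ P(exactly one pair)`). -/
def C017 : Prop :=
  ∀ {V E : Type} [Fintype E] [DecidableEq E] (G : MultiGraph V E) (p : E → ℝ), IsProb p →
    ∀ a b c : V,
      (G.law3 p a b c 0 + G.law3 p a b c 1) *
          (G.law3 p a b c 2 + G.law3 p a b c 3 + G.law3 p a b c 4) ≤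
        G.law3 p a b c 1 + G.law3 p a b c 2 + G.law3 p a b c 3

open Classical in
/-- The indicator of the row `s` as a function of the marked partition. -/
noncomputable def rowInd3 (s : Fin 5) (σ : Setoid (Fin 3)) : ℝ :=
  if σ = Setoid.ker (rgs3 s) then 1 else 0

/-- **The kernel of C-017**: `[σ one pair] − [σ joins ab]·[τ separates ab]` through the rows
(`one pair` = rows `1, 2, 3`; `a ~ b` = rows `0, 1`; `a ≁ b` = rows `2, 3, 4`). -/
noncomputable def kernel17 (σ τ : Setoid (Fin 3)) : ℝ :=
  (rowInd3 1 σ + rowInd3 2 σ + rowInd3 3 σ) -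
    (rowInd3 0 σ + rowInd3 1 σ) * (rowInd3 2 τ + rowInd3 3 τ + rowInd3 4 τ)

namespace MultiGraph

variable {V E : Type*} (G : MultiGraph V E) [Fintype E] [DecidableEq E]

open Classical in
/-- A row of `law3` as the expectation of its indicator. -/
theorem law3_eq_sum_rowInd3 (p : E → ℝ) (a b c : V) (s : Fin 5) :
    G.law3 p a b c s = ∑ ω : Config E, weight p ω * rowInd3 s (G.markedPartition ω ![a, b, c]) := by
  unfold law3
  rw [G.partitionEvent_eq_partitionSetoidEvent, G.prob_partitionSetoidEvent_eq_sum]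
  refine Finset.sum_congr rfl fun ω _ => ?_
  unfold rowInd3
  split_ifs <;> simp

/-- A two-copy sum of a function of the first copy alone. -/
theorem sum_sum_weight_mul_left (p : E → ℝ) (f : Config E → ℝ) :
    (∑ ω : Config E, ∑ ω' : Config E, weight p ω * weight p ω' * f ω) =
      ∑ ω : Config E, weight p ω * f ω := by
  refine Finset.sum_congr rfl fun ω _ => ?_
  calc ∑ ω' : Config E, weight p ω * weight p ω' * f ω
      = (weight p ω * f ω) * ∑ ω' : Config E, weight p ω' := by
        rw [Finset.mul_sum]
        exact Finset.sum_congr rfl fun ω' _ => by ring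
    _ = weight p ω * f ω := by rw [sum_weight, mul_one]

/-- A two-copy sum of a product splits. -/
theorem sum_sum_weight_mul_mul (p : E → ℝ) (g h : Config E → ℝ) :
    (∑ ω : Config E, ∑ ω' : Config E, weight p ω * weight p ω' * (g ω * h ω')) =
      (∑ ω : Config E, weight p ω * g ω) * ∑ ω' : Config E, weight p ω' * h ω' := by
  rw [Finset.sum_mul_sum]
  exact Finset.sum_congr rfl fun ω _ => Finset.sum_congr rfl fun ω' _ => by ring

/-- **The quadratic form of `kernel17` is the C-017 slack**
`(y₁ + y₂ + y₃) − (x + y₁)(y₂ + y₃ + z)`. -/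
theorem quadForm_kernel17 (p : E → ℝ) (a b c : V) :
    G.quadForm p ![a, b, c] kernel17 =
      (G.law3 p a b c 1 + G.law3 p a b c 2 + G.law3 p a b c 3) -
        (G.law3 p a b c 0 + G.law3 p a b c 1) *
          (G.law3 p a b c 2 + G.law3 p a b c 3 + G.law3 p a b c 4) := by
  unfold quadForm kernel17
  simp only [mul_sub, Finset.sum_sub_distrib]
  rw [sum_sum_weight_mul_left, sum_sum_weight_mul_mul]
  simp only [law3_eq_sum_rowInd3, mul_add, Finset.sum_add_distrib]

end MultiGraph

/-- C-017 is the nonnegativity of the quadratic form of `kernel17`. -/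
theorem C017_iff_quadForm : C017 ↔
    ∀ {V E : Type} [Fintype E] [DecidableEq E] (G : MultiGraph V E) (p : E → ℝ), IsProb p →
      ∀ a b c : V, 0 ≤ G.quadForm p ![a, b, c] kernel17 := by
  constructor
  · intro h V E _ _ G p hp a b c
    rw [G.quadForm_kernel17]
    have := h G p hp a b c
    linarith
  · intro h V E _ _ G p hp a b c
    have := h G p hp a b c
    rw [G.quadForm_kernel17] at this
    linarith

/-- **C-017 on every multigraph with at most `N` vertices**, every `p`, every three marks. -/
def C017UpTo (N : ℕ) : Prop :=
  ∀ {V E : Type} [Fintype V] [Fintype E] [DecidableEq E], Fintype.card V ≤ N →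
    ∀ (G : MultiGraph V E) (p : E → ℝ), IsProb p → ∀ a b c : V,
      (G.law3 p a b c 0 + G.law3 p a b c 1) *
          (G.law3 p a b c 2 + G.law3 p a b c 3 + G.law3 p a b c 4) ≤
        G.law3 p a b c 1 + G.law3 p a b c 2 + G.law3 p a b c 3

/-- **C-017 on ≤ N vertices from the class positivity of its kernel on ≤ N vertices.** -/
theorem C017UpTo_of_classPositive {N : ℕ} (h : ClassPositiveUpTo 3 N kernel17) : C017UpTo N := by
  intro V E _ _ _ hV G p hp a b c
  have := QuadNonnegUpTo_of_classPositive h hV G p hp ![a, b, c]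
  rw [G.quadForm_kernel17] at this
  linarith

/-- **C-017 on ≤ N vertices from the simple-graph class census** (mine-3's exhaustive class
positivity on ≤ 6 vertices is `ClassPositiveSimpleUpTo 3 6 kernel17`). -/
theorem C017UpTo_of_simple {N : ℕ} (h : ClassPositiveSimpleUpTo 3 N kernel17) : C017UpTo N :=
  C017UpTo_of_classPositive (ClassPositiveUpTo_of_simple h)

end PercRepro
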